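import Summits.BirchSwinnertonDyer.BirchSwinnertonDyer.Theorems.SylvesterTwoHeegnerIndexYinPointOfToricDescent
import HarnessLib

/-!
# Route `SylvesterTwoHeegnerIndex` (rung K7t): THEOREM C′ — the FULL SIGNED TORIC SUM and the ANTI-TRACE
# (memo two v2.10 §52.5 (D1) + (B5)), kernel over the actual field of definition

HONEST FRAMING (cell b2b-bsdres, seat x1b GEN 53 = O12 class lead; file `--supports
stmt-BirchSwinnertonDyer-19802 --as helper`; C′ and THEOREM C stay OPEN; nothing here is a mechanism, a
definition or a named fact). Third file of the descent layer (x1b [161] `…YinPointToricDescent`, [162]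
`…YinPointOfToricDescent`). In the memo the toric vanishing (S3)/(S4) is a statement about the full signed sum
`Σ_{τ ∈ Gal(𝔽/K)} κ(τ)·τ•w` (`κ = ±1` the quadratic character of `K(i)/K`; the CM character `χ` is absorbed into
`w = ϕφ(x″_a) ∈ E_p(𝔽)` by `g(ϕQ) = ϕ([χ(g)]·gQ)`), while the descent step ([162]
`exists_eq_two_smul_of_trace_of_antiTrace`) consumes the ANTI-TRACE `R − σ̃R` of the transversal sum
`R = Σ_i g_i•w`. The passage is coset bookkeeping with (B5) «`h•w − w` torsion for `h ∈ H = Gal(𝔽/F♭)`»: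
`Σ_τ κ(τ)·τ•w = |H|•(R − σ̃R) + torsion`. Kernel here, for ANY `W/ℚ` and ANY finite `𝔽/K`; the coset structure
`Gal(𝔽/K) = ⨆_{i,j} {g_i h_j, σ̃ g_i h_j}` enters as an explicit bijection `I × H × Bool ≃ Gal(𝔽/K)`:

* `isOfFinAddOrder_antiTrace_of_doubleSum` — double coset sum torsion + (B5) ⟹ anti-trace torsion;
* `signedSum_eq_doubleSum` — reindexing the signed sum over `Gal(𝔽/K)` by the bijection;
* **`isOfFinAddOrder_antiTrace_of_signedSum`** — TORIC VANISHING (signed sum torsion) + (B5) ⟹ ANTI-TRACE TORSION.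

With [161] §4 (`card_smul_map_eq_neg_map_sum`: (C1) ⇒ (C2)) and [162] §0, an 𝔽-level typed package {(C1) exact,
the transversal `g` commuting with `σ̃`, (B5), the coset bijection with `κ`, the signed-sum torsion, (B4) as
«`2p²` not a cube in `𝔽`»} reaches `Z = 2•Z′` in `B(K)` and item 19802 BY NAME with no descent to `K(i)`.
NO definition, NO named fact, NO sorry; axioms standard; closes no item; nothing booked; no label moves.
References: MEMO-bsd-cm-two v2.10 (FROZEN 08c1ecd6da1b763f) §52.3 (B2)/(B3)/(B5), §52.5 (D1); referee g43
countersign; pub/bsd-cm STATUS D142, D148.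
-/

set_option autoImplicit false
-- the Summit-side namespace `Summit.BirchSwinnertonDyer.BirchSwinnertonDyer.…` (summit = problem) is mandated by D-0017
set_option linter.dupNamespace false

noncomputable section

open scoped Classical

open WeierstrassCurve WeierstrassCurve.Affine WeierstrassCurve.Affine.Point

namespace Summit.BirchSwinnertonDyer.BirchSwinnertonDyer.Theorems.SylvesterTwoYinToricDescent

/-! ## §1 memo (D1): the FULL SIGNED TORIC SUM and the anti-trace

In the memo (§52.5 (D1)) the toric vanishing (S3)/(S4) is a statement about the full signed sum
`Σ_{τ ∈ Gal(𝔽/K)} κ(τ)·τ•w` (`κ = ±1` the quadratic character of `K(i)/K`; the CM character `χ` is absorbed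
into `w = ϕφ(x″_a)`), while the descent step consumes the ANTI-TRACE `R − σ̃R` of the transversal sum
`R = Σ_i g_i•w`. The passage is coset bookkeeping with (B5) «`h•w − w` torsion for `h ∈ H`»:
`Σ_τ κ(τ)·τ•w = |H|•(R − σ̃R) + torsion`, so one is torsion iff the other is. Kernel below, for ANY `W/ℚ` and
ANY finite extension `𝔽/K`; the coset structure `Gal(𝔽/K) = ⨆_{i,j} {g_i h_j, σ̃ g_i h_j}` enters as an
explicit bijection `I × H × Bool ≃ Gal(𝔽/K)`. -/

section SignedSum

variable {K : Type*} [Field K] [CharZero K] {F : Type*} [Field F] [CharZero F] [Algebra K F]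
  (W : WeierstrassCurve ℚ)

/-- **The double coset sum is `|H|•(anti-trace)` modulo torsion.** `g : I → Gal(𝔽/K)`, `h : H → Gal(𝔽/K)`
finite families, `σ̃ ∈ Gal(𝔽/K)`, `w ∈ W(𝔽)` with `h_j•w − w` torsion for all `j` ((B5)). If the double sum
`Σ_i Σ_j ((g_i h_j)•w − σ̃(g_i h_j)•w)` is torsion, then so is the anti-trace `R − σ̃R`, `R := Σ_i g_i•w`:
the double sum equals `|H|•(R − σ̃R) + Σ_i Σ_j (g_i t_j − σ̃ g_i t_j)`, `t_j := h_j•w − w`. Memo §52.5 (D1).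
[folklore] -/
theorem isOfFinAddOrder_antiTrace_of_doubleSum {I H : Type*} [Fintype I] [Fintype H] [Nonempty H]
    (g : I → (F ≃ₐ[K] F)) (h : H → (F ≃ₐ[K] F)) (σ' : F ≃ₐ[K] F) (w : (W.baseChange F).toAffine.Point)
    (hH : ∀ j, IsOfFinAddOrder (Affine.Point.map (h j : F →ₐ[K] F) w - w))
    (hsum : IsOfFinAddOrder (∑ i, ∑ j,
      (Affine.Point.map (g i : F →ₐ[K] F) (Affine.Point.map (h j : F →ₐ[K] F) w) -
        Affine.Point.map (σ' : F →ₐ[K] F)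
          (Affine.Point.map (g i : F →ₐ[K] F) (Affine.Point.map (h j : F →ₐ[K] F) w))))) :
    IsOfFinAddOrder ((∑ i, Affine.Point.map (g i : F →ₐ[K] F) w) -
      Affine.Point.map (σ' : F →ₐ[K] F) (∑ i, Affine.Point.map (g i : F →ₐ[K] F) w)) := by
  set t : H → (W.baseChange F).toAffine.Point := fun j => Affine.Point.map (h j : F →ₐ[K] F) w - w with ht
  -- the torsion tail
  set T : (W.baseChange F).toAffine.Point := ∑ i, ∑ j,
    (Affine.Point.map (g i : F →ₐ[K] F) (t j) -
      Affine.Point.map (σ' : F →ₐ[K] F) (Affine.Point.map (g i : F →ₐ[K] F) (t j))) with hT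
  have hTfin : IsOfFinAddOrder T :=
    (AddCommGroup.torsion _).sum_mem fun i _ => (AddCommGroup.torsion _).sum_mem fun j _ =>
      (AddCommGroup.torsion _).sub_mem
        ((AddCommGroup.mem_torsion _).mpr ((Affine.Point.map (g i : F →ₐ[K] F)).isOfFinAddOrder (hH j)))
        ((AddCommGroup.mem_torsion _).mpr ((Affine.Point.map (σ' : F →ₐ[K] F)).isOfFinAddOrder
          ((Affine.Point.map (g i : F →ₐ[K] F)).isOfFinAddOrder (hH j))))
  -- the decomposition of the double sum
  have hdec : (∑ i, ∑ j,
      (Affine.Point.map (g i : F →ₐ[K] F) (Affine.Point.map (h j : F →ₐ[K] F) w) -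
        Affine.Point.map (σ' : F →ₐ[K] F)
          (Affine.Point.map (g i : F →ₐ[K] F) (Affine.Point.map (h j : F →ₐ[K] F) w)))) =
      Fintype.card H • ((∑ i, Affine.Point.map (g i : F →ₐ[K] F) w) -
        Affine.Point.map (σ' : F →ₐ[K] F) (∑ i, Affine.Point.map (g i : F →ₐ[K] F) w)) + T := by
    have hw : ∀ j, Affine.Point.map (h j : F →ₐ[K] F) w = w + t j := fun j => by
      simp only [ht, add_sub_cancel]
    have e1 : ∀ i j,
        Affine.Point.map (g i : F →ₐ[K] F) (Affine.Point.map (h j : F →ₐ[K] F) w) -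
          Affine.Point.map (σ' : F →ₐ[K] F)
            (Affine.Point.map (g i : F →ₐ[K] F) (Affine.Point.map (h j : F →ₐ[K] F) w)) =
        (Affine.Point.map (g i : F →ₐ[K] F) w -
            Affine.Point.map (σ' : F →ₐ[K] F) (Affine.Point.map (g i : F →ₐ[K] F) w)) +
          (Affine.Point.map (g i : F →ₐ[K] F) (t j) -
            Affine.Point.map (σ' : F →ₐ[K] F) (Affine.Point.map (g i : F →ₐ[K] F) (t j))) := by
      intro i j
      rw [hw, map_add, map_add]
      abel
    simp_rw [e1, Finset.sum_add_distrib]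
    rw [hT]
    congr 1
    simp_rw [Finset.sum_const, Finset.card_univ]
    rw [← Finset.smul_sum, Finset.sum_sub_distrib, map_sum]
  -- conclude: `|H| • (anti-trace) = double sum − T` is torsion
  have hcard : Fintype.card H ≠ 0 := Fintype.card_ne_zero
  refine IsOfFinAddOrder.of_nsmul ?_ hcard
  have e2 : Fintype.card H • ((∑ i, Affine.Point.map (g i : F →ₐ[K] F) w) -
      Affine.Point.map (σ' : F →ₐ[K] F) (∑ i, Affine.Point.map (g i : F →ₐ[K] F) w)) =
      (∑ i, ∑ j,
        (Affine.Point.map (g i : F →ₐ[K] F) (Affine.Point.map (h j : F →ₐ[K] F) w) -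
          Affine.Point.map (σ' : F →ₐ[K] F)
            (Affine.Point.map (g i : F →ₐ[K] F) (Affine.Point.map (h j : F →ₐ[K] F) w)))) + -T := by
    rw [hdec]; abel
  rw [e2]
  exact hsum.add hTfin.neg

/-- **The full signed sum over `Gal(𝔽/K)`, reindexed by the coset structure.** If
`(i, j, b) ↦ g_i h_j` (`b = false`) / `σ̃ g_i h_j` (`b = true`) is a bijection `I × H × Bool ≃ Gal(𝔽/K)` and
`κ = 1` on the `g_i h_j`, `κ = −1` on the `σ̃ g_i h_j` (memo: `G′ = Gal(𝔽/K(i)) = ⨆ g_i H`, `Gal = G′ ⊔ σ̃G′`,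
`κ` the quadratic character of `K(i)/K`), then `Σ_τ κ(τ)•τ•w = Σ_i Σ_j ((g_i h_j)•w − (σ̃ g_i h_j)•w)`.
[folklore] -/
theorem signedSum_eq_doubleSum [FiniteDimensional K F] {I H : Type*} [Fintype I] [Fintype H]
    (g : I → (F ≃ₐ[K] F)) (h : H → (F ≃ₐ[K] F)) (σ' : F ≃ₐ[K] F) (e : I × H × Bool ≃ (F ≃ₐ[K] F))
    (he0 : ∀ i j, e (i, j, false) = g i * h j) (he1 : ∀ i j, e (i, j, true) = σ' * (g i * h j))
    (κ : (F ≃ₐ[K] F) → ℤ) (hκ0 : ∀ i j, κ (g i * h j) = 1) (hκ1 : ∀ i j, κ (σ' * (g i * h j)) = -1)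
    (w : (W.baseChange F).toAffine.Point) :
    ∑ τ : F ≃ₐ[K] F, κ τ • Affine.Point.map (τ : F →ₐ[K] F) w =
      ∑ i, ∑ j,
        (Affine.Point.map (g i : F →ₐ[K] F) (Affine.Point.map (h j : F →ₐ[K] F) w) -
          Affine.Point.map (σ' : F →ₐ[K] F)
            (Affine.Point.map (g i : F →ₐ[K] F) (Affine.Point.map (h j : F →ₐ[K] F) w))) := by
  rw [← e.sum_comp, Fintype.sum_prod_type]
  refine Finset.sum_congr rfl fun i _ => ?_
  rw [Fintype.sum_prod_type]
  refine Finset.sum_congr rfl fun j _ => ?_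
  rw [Fintype.sum_bool, he1, he0, hκ1, hκ0, neg_smul, one_smul, one_smul]
  simp only [map_galois_mul]
  abel

/-- **TORIC VANISHING ⇒ ANTI-TRACE TORSION** (memo §52.5 (D1) + (B5), kernel): with the coset bijection
and `κ` as above, `h_j•w − w` torsion for all `j`, and the full signed sum `Σ_τ κ(τ)•τ•w` TORSION (the image
under `ϕ` of the vanishing YZZ toric period, (S3)/(S4)), the anti-trace `R − σ̃R` of `R = Σ_i g_i•w` is
torsion — the `hanti` input of `exists_eq_two_smul_of_trace_of_antiTrace`. [folklore] -/
theorem isOfFinAddOrder_antiTrace_of_signedSum [FiniteDimensional K F] {I H : Type*} [Fintype I] [Fintype H]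
    [Nonempty H] (g : I → (F ≃ₐ[K] F)) (h : H → (F ≃ₐ[K] F)) (σ' : F ≃ₐ[K] F)
    (e : I × H × Bool ≃ (F ≃ₐ[K] F))
    (he0 : ∀ i j, e (i, j, false) = g i * h j) (he1 : ∀ i j, e (i, j, true) = σ' * (g i * h j))
    (κ : (F ≃ₐ[K] F) → ℤ) (hκ0 : ∀ i j, κ (g i * h j) = 1) (hκ1 : ∀ i j, κ (σ' * (g i * h j)) = -1)
    (w : (W.baseChange F).toAffine.Point)
    (hH : ∀ j, IsOfFinAddOrder (Affine.Point.map (h j : F →ₐ[K] F) w - w))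
    (hTS : IsOfFinAddOrder (∑ τ : F ≃ₐ[K] F, κ τ • Affine.Point.map (τ : F →ₐ[K] F) w)) :
    IsOfFinAddOrder ((∑ i, Affine.Point.map (g i : F →ₐ[K] F) w) -
      Affine.Point.map (σ' : F →ₐ[K] F) (∑ i, Affine.Point.map (g i : F →ₐ[K] F) w)) := by
  rw [signedSum_eq_doubleSum W g h σ' e he0 he1 κ hκ0 hκ1 w] at hTS
  exact isOfFinAddOrder_antiTrace_of_doubleSum W g h σ' w hH hTS

end SignedSum

end Summit.BirchSwinnertonDyer.BirchSwinnertonDyer.Theorems.SylvesterTwoYinToricDescent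

end
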